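import Summits.RiemannHypothesis.RiemannHypothesis.Theorems.PfPersistenceEdgeLawCutKernel

/-!
# Edge law — the cusp scale of a window (RH-free calculus)

Part of the pub-rhpf THEORY-2 programme (mechanism / rigidity of the Weil window bottom; no RH
claims). The ground state `u` of the window `[-a, a]` is expected to vanish at the edge like
`τ / √(log 1/(a − |x|))` (the *cusp*; the edge law reads the edge intensity `τ²` off the energy
profile). This file sets up the one-dimensional calculus of the cusp scale:

* `cuspScale a = max (8a) 1`, `cuspLog a δ = log(cuspScale a / δ)` (so `cuspLog a δ ≥ log 8 > 2`
  for `0 < δ ≤ a` and `cuspLog a δ ≥ log(1/δ)`);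
* the **cusp weight** `cuspWeight a δ = 1/(δ · cuspLog a δ · √(cuspLog a δ))` (`≍ 1/(δ log^{3/2}(1/δ))`
  at `δ → 0⁺`), positive and decreasing on `(0, a]`;
* the **cusp primitive** `cuspPrim a δ = 2/√(cuspLog a δ)` (`cuspPrim a 0 = 0`), increasing and
  concave on `[0, a]` with derivative `cuspWeight a δ`, hence sub-additive.

The odd cusp coordinate of the window built from `cuspPrim` is in `PfPersistenceEdgeLawCuspCoord`;
a function Lipschitz in it is the RH-free regularity hypothesis under which the interior dilation
defect of a Weil ground state is `o(η)` (`PfPersistenceEdgeLawCuspDefect`).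

Sources: E. Bombieri, *Remarks on Weil's quadratic functional in the theory of prime numbers I*,
Rend. Mat. Acc. Lincei (9) 11 (2000) §4 (the variational setting; the dilation in the proof of
Thm 5); the weight is the logarithmic analogue of the boundary gradient bound `|∇u| ≤ C δ^{s-1}`
of X. Ros-Oton, J. Serra, *The Dirichlet problem for the fractional Laplacian: regularity up to
the boundary*, J. Math. Pures Appl. 101 (2014) Thm 1.2.
-/

set_option linter.dupNamespace false

noncomputable section

open MeasureTheory Set Filter
open scoped Topology

namespace Summit.RiemannHypothesis.RiemannHypothesis.Theorems.PfPersistence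
/-! ## The cusp logarithm -/

/-- The **cusp scale** `S_a = max(8a, 1)`. [folklore] -/
def cuspScale (a : ℝ) : ℝ := max (8 * a) 1

/-- `1 ≤ S_a`. [folklore] -/
theorem one_le_cuspScale (a : ℝ) : 1 ≤ cuspScale a := le_max_right _ _

/-- `0 < S_a`. [folklore] -/
theorem cuspScale_pos (a : ℝ) : 0 < cuspScale a := one_pos.trans_le (one_le_cuspScale a)

/-- `8a ≤ S_a`. [folklore] -/
theorem eight_mul_le_cuspScale (a : ℝ) : 8 * a ≤ cuspScale a := le_max_left _ _

/-- The **cusp logarithm** `Λ_a(δ) = log(S_a/δ)`. [folklore] -/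
def cuspLog (a δ : ℝ) : ℝ := Real.log (cuspScale a / δ)

/-- `Λ_a(0) = 0` (junk value of `log 0`). [folklore] -/
theorem cuspLog_zero (a : ℝ) : cuspLog a 0 = 0 := by simp [cuspLog]

/-- `Λ_a(δ) = log S_a + log(1/δ)` for `δ > 0`. [folklore] -/
theorem cuspLog_eq (a : ℝ) {δ : ℝ} (hδ : 0 < δ) :
    cuspLog a δ = Real.log (cuspScale a) + Real.log (1 / δ) := by
  rw [cuspLog, Real.log_div (cuspScale_pos a).ne' hδ.ne', log_one_div_eq_neg]
  ring

/-- `2 < Λ_a(δ)` for `0 < δ ≤ a`. [folklore] -/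
theorem two_lt_cuspLog {a δ : ℝ} (hδ : 0 < δ) (hδa : δ ≤ a) : 2 < cuspLog a δ := by
  have h8 : (8 : ℝ) ≤ cuspScale a / δ := by
    rw [le_div_iff₀ hδ]
    linarith [eight_mul_le_cuspScale a]
  -- `2 < log 8 = 3 log 2` (also `Literature.NumberTheory.Sieve.BFI.L1.two_lt_log_eight`)
  have h2 : (2 : ℝ) < Real.log 8 := by
    rw [show (8 : ℝ) = 2 ^ 3 by norm_num, Real.log_pow]
    have := Real.log_two_gt_d9
    push_cast
    linarith
  exact h2.trans_le (Real.log_le_log (by norm_num) h8)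

/-- `0 < Λ_a(δ)` for `0 < δ ≤ a`. [folklore] -/
theorem cuspLog_pos {a δ : ℝ} (hδ : 0 < δ) (hδa : δ ≤ a) : 0 < cuspLog a δ :=
  zero_lt_two.trans (two_lt_cuspLog hδ hδa)

/-- `log(1/δ) ≤ Λ_a(δ)` for `δ > 0` (`S_a ≥ 1`). [folklore] -/
theorem log_one_div_le_cuspLog (a : ℝ) {δ : ℝ} (hδ : 0 < δ) : Real.log (1 / δ) ≤ cuspLog a δ := by
  rw [cuspLog_eq a hδ]
  have := Real.log_nonneg (one_le_cuspScale a)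
  linarith

/-- `Λ_a` is antitone on `(0, ∞)`. [folklore] -/
theorem cuspLog_antitone (a : ℝ) {δ₁ δ₂ : ℝ} (h1 : 0 < δ₁) (h12 : δ₁ ≤ δ₂) :
    cuspLog a δ₂ ≤ cuspLog a δ₁ := by
  rw [cuspLog_eq a h1, cuspLog_eq a (h1.trans_le h12)]
  have := log_one_div_antitone h1 h12
  linarith

/-- `Λ_a(2δ) ≥ Λ_a(δ)/2` hence `1/Λ_a(2δ) ≤ 2/Λ_a(δ)`, for `0 < δ`, `2δ ≤ a`
(`Λ(2δ) = Λ(δ) − log 2 ≥ Λ(δ) − 1 ≥ Λ(δ)/2`). [folklore] -/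
theorem cuspLog_two_mul_ge {a δ : ℝ} (hδ : 0 < δ) (h2 : 2 * δ ≤ a) :
    cuspLog a δ / 2 ≤ cuspLog a (2 * δ) := by
  have hL := two_lt_cuspLog (by linarith : 0 < 2 * δ) h2
  have e : cuspLog a (2 * δ) = cuspLog a δ - Real.log 2 := by
    rw [cuspLog_eq a hδ, cuspLog_eq a (by linarith : 0 < 2 * δ), one_div, one_div, mul_inv,
      Real.log_mul (by norm_num) (inv_ne_zero hδ.ne'), Real.log_inv]
    ring
  have := Real.log_two_lt_d9
  linarith

/-- `HasDerivAt Λ_a (−1/δ) δ` for `δ > 0`. [folklore] -/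
theorem hasDerivAt_cuspLog (a : ℝ) {δ : ℝ} (hδ : 0 < δ) : HasDerivAt (cuspLog a) (-(1 / δ)) δ := by
  have h := (hasDerivAt_log_one_div hδ.ne').const_add (Real.log (cuspScale a))
  refine h.congr_of_eventuallyEq ?_
  filter_upwards [Ioi_mem_nhds hδ] with x hx
  exact cuspLog_eq a hx

/-- `Λ_a(δ) → +∞` as `δ → 0⁺`. [folklore] -/
theorem tendsto_cuspLog_atTop (a : ℝ) : Tendsto (cuspLog a) (𝓝[>] 0) atTop := by
  have h1 : Tendsto (fun δ : ℝ ↦ cuspScale a * δ⁻¹) (𝓝[>] 0) atTop :=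
    tendsto_inv_nhdsGT_zero.const_mul_atTop (cuspScale_pos a)
  have h2 := Real.tendsto_log_atTop.comp h1
  refine h2.congr fun δ ↦ ?_
  simp [cuspLog, div_eq_mul_inv]

/-! ## The cusp weight and the cusp primitive -/

/-- The **cusp weight** `ψ_a(δ) = 1/(δ Λ_a(δ)^{3/2})`. [folklore] -/
def cuspWeight (a δ : ℝ) : ℝ := 1 / (δ * (cuspLog a δ * Real.sqrt (cuspLog a δ)))

/-- The **cusp primitive** `G_a(δ) = 2/√Λ_a(δ)` (`G_a' = ψ_a`, `G_a(0) = 0`). [folklore] -/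
def cuspPrim (a δ : ℝ) : ℝ := 2 / Real.sqrt (cuspLog a δ)

/-- `ψ_a(δ) > 0` for `0 < δ ≤ a`. [folklore] -/
theorem cuspWeight_pos {a δ : ℝ} (hδ : 0 < δ) (hδa : δ ≤ a) : 0 < cuspWeight a δ := by
  have hL := cuspLog_pos hδ hδa
  have hs := Real.sqrt_pos.2 hL
  unfold cuspWeight
  positivity

/-- `ψ_a(δ) ≥ 0` always (junk-safe). [folklore] -/
theorem cuspWeight_nonneg_of {a δ : ℝ} (hδ : 0 ≤ δ) (hδa : δ ≤ a) : 0 ≤ cuspWeight a δ := by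
  rcases hδ.eq_or_lt with h | h
  · rw [← h, cuspWeight, zero_mul, div_zero]
  · exact (cuspWeight_pos h hδa).le

/-- `G_a(0) = 0`. [folklore] -/
theorem cuspPrim_zero (a : ℝ) : cuspPrim a 0 = 0 := by simp [cuspPrim, cuspLog_zero]

/-- `G_a ≥ 0`. [folklore] -/
theorem cuspPrim_nonneg (a δ : ℝ) : 0 ≤ cuspPrim a δ := div_nonneg zero_le_two (Real.sqrt_nonneg _)

/-- `G_a(δ)² = 4/Λ_a(δ)` for `0 < δ ≤ a`. [folklore] -/
theorem cuspPrim_sq {a δ : ℝ} (hδ : 0 < δ) (hδa : δ ≤ a) : cuspPrim a δ ^ 2 = 4 / cuspLog a δ := by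
  rw [cuspPrim, div_pow, Real.sq_sqrt (cuspLog_pos hδ hδa).le]
  norm_num

/-- `G_a` is monotone on `[0, a]`. [folklore] -/
theorem cuspPrim_mono {a δ₁ δ₂ : ℝ} (h1 : 0 ≤ δ₁) (h12 : δ₁ ≤ δ₂) (h2a : δ₂ ≤ a) :
    cuspPrim a δ₁ ≤ cuspPrim a δ₂ := by
  rcases h1.eq_or_lt with h | h1
  · rw [← h, cuspPrim_zero]
    exact cuspPrim_nonneg _ _
  have hL2 := cuspLog_pos (h1.trans_le h12) h2a
  unfold cuspPrim
  exact div_le_div_of_nonneg_left zero_le_two (Real.sqrt_pos.2 hL2)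
    (Real.sqrt_le_sqrt (cuspLog_antitone a h1 h12))

/-- `G_a(δ) → 0` as `δ → 0⁺`. [folklore] -/
theorem tendsto_cuspPrim_zero (a : ℝ) : Tendsto (cuspPrim a) (𝓝[>] 0) (𝓝 0) := by
  have h1 : Tendsto (fun δ ↦ (cuspLog a δ)⁻¹) (𝓝[>] 0) (𝓝 0) :=
    tendsto_inv_atTop_zero.comp (tendsto_cuspLog_atTop a)
  have h2 := (h1.sqrt).const_mul 2
  rw [Real.sqrt_zero, mul_zero] at h2
  refine h2.congr fun δ ↦ ?_
  rw [cuspPrim, Real.sqrt_inv, div_eq_mul_inv]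

/-- `G_a` is continuous from the right at `0` (within `[0, ∞)`). [folklore] -/
theorem continuousWithinAt_cuspPrim_zero (a : ℝ) : ContinuousWithinAt (cuspPrim a) (Ici 0) 0 := by
  rw [← continuousWithinAt_Ioi_iff_Ici, ContinuousWithinAt, cuspPrim_zero]
  exact tendsto_cuspPrim_zero a

/-- `HasDerivAt G_a (ψ_a(δ)) δ` for `0 < δ ≤ a`. [folklore] -/
theorem hasDerivAt_cuspPrim {a δ : ℝ} (hδ : 0 < δ) (hδa : δ ≤ a) :
    HasDerivAt (cuspPrim a) (cuspWeight a δ) δ := by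
  have hL := cuspLog_pos hδ hδa
  have hs : 0 < Real.sqrt (cuspLog a δ) := Real.sqrt_pos.2 hL
  have h1 : HasDerivAt (fun x ↦ Real.sqrt (cuspLog a x))
      (-(1 / δ) / (2 * Real.sqrt (cuspLog a δ))) δ := (hasDerivAt_cuspLog a hδ).sqrt hL.ne'
  have h2 := (h1.inv hs.ne').const_mul 2
  have e : cuspPrim a = fun x ↦ 2 * (Real.sqrt (cuspLog a x))⁻¹ := by
    funext x
    rw [cuspPrim, div_eq_mul_inv]
  rw [e]
  refine h2.congr_deriv ?_
  rw [cuspWeight, Real.sq_sqrt hL.le]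
  field_simp

/-- `G_a` is continuous on `[0, a]`. [folklore] -/
theorem continuousOn_cuspPrim {a : ℝ} : ContinuousOn (cuspPrim a) (Icc 0 a) := by
  intro x hx
  rcases hx.1.eq_or_lt with h | h
  · rw [← h]
    exact (continuousWithinAt_cuspPrim_zero a).mono Icc_subset_Ici_self
  · exact (hasDerivAt_cuspPrim h hx.2).continuousAt.continuousWithinAt

/-- The reciprocal weight `φ(δ) = δ Λ √Λ` has derivative `√Λ (Λ − 3/2)` (`δ > 0`, `Λ = Λ_a(δ) > 0`).
[folklore] -/
theorem hasDerivAt_inv_cuspWeight {a δ : ℝ} (hδ : 0 < δ) (hδa : δ ≤ a) :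
    HasDerivAt (fun x ↦ x * (cuspLog a x * Real.sqrt (cuspLog a x)))
      (Real.sqrt (cuspLog a δ) * (cuspLog a δ - 3 / 2)) δ := by
  have hL := cuspLog_pos hδ hδa
  have hs : 0 < Real.sqrt (cuspLog a δ) := Real.sqrt_pos.2 hL
  have hΛ := hasDerivAt_cuspLog a hδ
  have hsq : HasDerivAt (fun x ↦ Real.sqrt (cuspLog a x))
      (-(1 / δ) / (2 * Real.sqrt (cuspLog a δ))) δ := hΛ.sqrt hL.ne'
  have hprod := (hasDerivAt_id' δ).mul (hΛ.mul hsq)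
  refine hprod.congr_deriv ?_
  have key : ∀ s L : ℝ, 0 < s → L = s ^ 2 →
      1 * (L * s) + δ * (-(1 / δ) * s + L * (-(1 / δ) / (2 * s))) = s * (L - 3 / 2) := by
    intro s L hs hL
    subst hL
    field_simp
    ring
  exact key _ _ hs (Real.sq_sqrt hL.le).symm

/-- `ψ_a` is antitone on `(0, a]`: `ψ_a(δ₂) ≤ ψ_a(δ₁)` for `0 < δ₁ ≤ δ₂ ≤ a`
(`δ Λ^{3/2}` is increasing while `Λ > 3/2`). [folklore] -/
theorem cuspWeight_antitone {a δ₁ δ₂ : ℝ} (h1 : 0 < δ₁) (h12 : δ₁ ≤ δ₂) (h2a : δ₂ ≤ a) :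
    cuspWeight a δ₂ ≤ cuspWeight a δ₁ := by
  set φ : ℝ → ℝ := fun x ↦ x * (cuspLog a x * Real.sqrt (cuspLog a x)) with hφ
  have hmem : ∀ x ∈ Icc δ₁ δ₂, 0 < x ∧ x ≤ a := fun x hx ↦ ⟨h1.trans_le hx.1, hx.2.trans h2a⟩
  have hmono : MonotoneOn φ (Icc δ₁ δ₂) := by
    refine monotoneOn_of_hasDerivWithinAt_nonneg (convex_Icc δ₁ δ₂)
      (f' := fun x ↦ Real.sqrt (cuspLog a x) * (cuspLog a x - 3 / 2)) ?_ ?_ ?_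
    · exact fun x hx ↦ (hasDerivAt_inv_cuspWeight (hmem x hx).1 (hmem x hx).2).continuousAt
        |>.continuousWithinAt
    · intro x hx
      rw [interior_Icc] at hx
      exact (hasDerivAt_inv_cuspWeight (hmem x (Ioo_subset_Icc_self hx)).1
        (hmem x (Ioo_subset_Icc_self hx)).2).hasDerivWithinAt
    · intro x hx
      rw [interior_Icc] at hx
      have hx' := hmem x (Ioo_subset_Icc_self hx)
      have h2 := two_lt_cuspLog hx'.1 hx'.2
      exact mul_nonneg (Real.sqrt_nonneg _) (by linarith)
  have hle : φ δ₁ ≤ φ δ₂ := hmono (left_mem_Icc.2 h12) (right_mem_Icc.2 h12) h12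
  have hφ1 : 0 < φ δ₁ := by
    have hL := cuspLog_pos h1 (h12.trans h2a)
    have hs := Real.sqrt_pos.2 hL
    simp only [hφ]
    positivity
  unfold cuspWeight
  exact one_div_le_one_div_of_le hφ1 hle

/-- **Slope bound** (concavity of `G_a`): `G_a(δ₂) − G_a(δ₁) ≤ (δ₂ − δ₁) ψ_a(δ₁)` for
`0 < δ₁ ≤ δ₂ ≤ a`. [folklore] -/
theorem cuspPrim_sub_le_mul {a δ₁ δ₂ : ℝ} (h1 : 0 < δ₁) (h12 : δ₁ ≤ δ₂) (h2a : δ₂ ≤ a) :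
    cuspPrim a δ₂ - cuspPrim a δ₁ ≤ (δ₂ - δ₁) * cuspWeight a δ₁ := by
  have hmem : ∀ x ∈ Icc δ₁ δ₂, 0 < x ∧ x ≤ a := fun x hx ↦ ⟨h1.trans_le hx.1, hx.2.trans h2a⟩
  have hcont : ContinuousOn (cuspPrim a) (Icc δ₁ δ₂) := fun x hx ↦
    (hasDerivAt_cuspPrim (hmem x hx).1 (hmem x hx).2).continuousAt.continuousWithinAt
  have hdiff : DifferentiableOn ℝ (cuspPrim a) (interior (Icc δ₁ δ₂)) := by
    rw [interior_Icc]
    exact fun x hx ↦ (hasDerivAt_cuspPrim (hmem x (Ioo_subset_Icc_self hx)).1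
      (hmem x (Ioo_subset_Icc_self hx)).2).differentiableAt.differentiableWithinAt
  have hle : ∀ x ∈ interior (Icc δ₁ δ₂), deriv (cuspPrim a) x ≤ cuspWeight a δ₁ := by
    intro x hx
    rw [interior_Icc] at hx
    have hx' := hmem x (Ioo_subset_Icc_self hx)
    rw [(hasDerivAt_cuspPrim hx'.1 hx'.2).deriv]
    exact cuspWeight_antitone h1 hx.1.le hx'.2
  have := (convex_Icc δ₁ δ₂).image_sub_le_mul_sub_of_deriv_le hcont hdiff hle δ₁
    (left_mem_Icc.2 h12) δ₂ (right_mem_Icc.2 h12) h12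
  linarith

/-- **Sub-additivity** of the concave primitive: `G_a(δ + ℓ) − G_a(δ) ≤ G_a(ℓ)` for
`0 ≤ δ`, `0 ≤ ℓ`, `δ + ℓ ≤ a`. [folklore] -/
theorem cuspPrim_add_sub_le {a δ ℓ : ℝ} (hδ : 0 ≤ δ) (hℓ : 0 ≤ ℓ) (hsum : δ + ℓ ≤ a) :
    cuspPrim a (δ + ℓ) - cuspPrim a δ ≤ cuspPrim a ℓ := by
  rcases hℓ.eq_or_lt with h | hℓ
  · rw [← h, add_zero, sub_self, cuspPrim_zero]
  set φ : ℝ → ℝ := fun x ↦ cuspPrim a (x + ℓ) - cuspPrim a x with hφ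
  have hanti : AntitoneOn φ (Icc 0 (a - ℓ)) := by
    refine antitoneOn_of_hasDerivWithinAt_nonpos (convex_Icc 0 (a - ℓ))
      (f' := fun x ↦ cuspWeight a (x + ℓ) - cuspWeight a x) ?_ ?_ ?_
    · intro x hx
      refine ContinuousWithinAt.sub ?_ (continuousOn_cuspPrim x ⟨hx.1, by linarith [hx.2]⟩
        |>.mono (Icc_subset_Icc_right (by linarith)))
      exact ((hasDerivAt_cuspPrim (a := a) (δ := x + ℓ) (by linarith [hx.1]) (by linarith [hx.2]))
        |>.comp_add_const x ℓ).continuousAt.continuousWithinAt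
    · intro x hx
      rw [interior_Icc] at hx
      have h1 : HasDerivAt (fun x ↦ cuspPrim a (x + ℓ)) (cuspWeight a (x + ℓ)) x :=
        (hasDerivAt_cuspPrim (a := a) (δ := x + ℓ) (by linarith [hx.1]) (by linarith [hx.2]))
          |>.comp_add_const x ℓ
      exact (h1.sub (hasDerivAt_cuspPrim hx.1 (by linarith [hx.2]))).hasDerivWithinAt
    · intro x hx
      rw [interior_Icc] at hx
      have := cuspWeight_antitone hx.1 (by linarith : x ≤ x + ℓ) (by linarith [hx.2])
      linarith
  have h := hanti (left_mem_Icc.2 (by linarith)) (⟨hδ, by linarith⟩ : δ ∈ Icc 0 (a - ℓ)) hδ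
  simp only [hφ, zero_add, cuspPrim_zero, sub_zero] at h
  exact h

end Summit.RiemannHypothesis.RiemannHypothesis.Theorems.PfPersistence

end
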